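import Mathlib
import Summits.Ventures.PercRepro2.K5Kernel

/-!
# `K₅` WITH A HYPEREDGE: THE KRONECKER NUMBERS OF THE STAR COMPARISONS
(blind cell PercRepro2, typer-1 g9 → g10; mine-1 g18's MINE1-J1.md §23.1 — the two comparisons
`M(H, T, e) = N(H + T(1) + e(1)) − N(H + T(1))` and `TvT-(ii) = N(H + △(1,1,1)) − N(H + T(1))`)

Setting (mine-1 §23): `H = K₅` on the marks `(o, a₁, a₂, a₃, b) = (0, 1, 2, 3, 4)`; `T = {a, b, c}` three
marks (the neighbourhood of an unmarked vertex of degree `3`), `T(τ)` the HYPEREDGE on `T` of type `τ`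
(open in exactly `τ` of the three copies), `e ⊆ T` a pair of type `1`, `△(1,1,1)` the three edges of
the triangle on `T` each of type `1`; `N(·)` the typed count of the cleared `(ii)` at a profile `k′` on
`E(K₅)` (the signed number of triples `(ω₁, ω₂, ω₃)` of configurations with `ω₁ + ω₂ + ω₃ = k′`,
weighted by the four-term kernel `KII`).

Kernel form.  A hyperedge open in a copy merges its three marks, exactly as opening the three `K₅`
edges of its triangle in that copy; a parallel edge `e` open in a copy is the `K₅` edge `e` open.  So
every table of `H + T + e` at `(ω; t, ε)` is a `K₅` table of `K5Kernel.lean` at the configuration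
`ω ∨ t·△_T ∨ ε·{e}` (`orOn`), the Kronecker digits stay indexed by the `K₅` profile (`4^10` digits),
and a typed count with the extra edges of type `1` is a sum over the copies in which they are open.
The base is `KB3 = 2^23`: each certificate compares sums of at most `60` products of three Kronecker
numbers, whose digits are bounded by `60 · 3^10 < 2^22`, so the mask test at bit `22` (no borrow
anywhere) certifies the digitwise inequality exactly as in `K5Digits.lean`.

BIT TABLES (g10; the diagnosis of the g9 kernel failures).  The `TvT` certificates (`120` products, `64`
distinct masked tables) died in the kernel with `--memory=12288`'s graceful «excessive memory» error:
the kernel's whnf cache keeps the whole evaluation trace of every leaf `T (ω ∨ S)` (bitmask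
connectivity through `List.foldl`, ≈ 10⁶ cached terms per masked table), ≈ 55 masked tables being the
limit.  Here every table is evaluated ONCE into its `1024`-bit table `bits T = Σ_ω [T ω] 2^{idx2 ω}`
(`goB`), and the Kronecker tree `go3b` reads a leaf as `(bits T).testBit (idx2 (ω ∨ S))` — one
accelerated `Nat.testBit` — so a masked Kronecker number costs `1024` bit reads and no connectivity
trace: the worst `TvT` certificate (`T = {o, a₂, b}`, all `120` products nonzero) passes in `30 s`.
This file holds the definitions; the `decide +kernel` certificates are in `K5HyperCert*.lean`; the
identity `kron3 T S = Σ_ω [T (ω ∨ S)] · KB3^{idx ω}` is `K5HyperKron.lean`.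
-/

namespace Summit.Ventures.PercRepro2

namespace K5

/-- The pair `{a, b}` of marks as an edge mask on `K₅`. -/
def pairMask (a b : ℕ) : Fin 10 → Bool :=
  fun j => decide ((ea j = a ∧ eb j = b) ∨ (ea j = b ∧ eb j = a))

/-- The triangle on the marks `a, b, c` as an edge mask. -/
def triMask (a b c : ℕ) : Fin 10 → Bool := fun j => pairMask a b j || pairMask a c j || pairMask b c j

/-- The configuration with the edges of the mask `S` forced open. -/
def orOn (S : Fin 10 → Bool) (ω : Fin 10 → Bool) : Fin 10 → Bool := fun j => ω j || S j

/-- The union of two masks. -/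
def mOr (S S' : Fin 10 → Bool) : Fin 10 → Bool := fun j => S j || S' j

/-- The empty mask. -/
def mNone : Fin 10 → Bool := fun _ => false

/-- The base `2^23` of the comparison certificates (digits `< 2^22`). -/
def KB3 : ℕ := 2 ^ 23

/-- The base-2 index of a configuration (bit `e` = the state of edge `e`). -/
def idx2 (ω : Fin 10 → Bool) : ℕ :=
  (ω 0).toNat + 2 * (ω 1).toNat + 4 * (ω 2).toNat + 8 * (ω 3).toNat + 16 * (ω 4).toNat +
    32 * (ω 5).toNat + 64 * (ω 6).toNat + 128 * (ω 7).toNat + 256 * (ω 8).toNat + 512 * (ω 9).toNat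

/-- The bit table of `T` by the edge tree: `goB T (n+1) ω = goB T n ω[n ↦ 0] + 2^(2^n) · goB T n ω[n ↦ 1]`. -/
def goB (T : (Fin 10 → Bool) → Bool) : ℕ → (Fin 10 → Bool) → ℕ
  | 0, ω => (T ω).toNat
  | n + 1, ω => goB T n (Function.update ω (Fin.ofNat 10 n) false) +
      2 ^ (2 ^ n) * goB T n (Function.update ω (Fin.ofNat 10 n) true)

/-- The bit table of `T`: `Σ_ω [T ω] · 2^{idx2 ω}` (a `1024`-bit number, computed once per table). -/
def bits (T : (Fin 10 → Bool) → Bool) : ℕ := goB T 10 (fun _ => false)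

/-- The Kronecker tree in base `KB3` of a bit table `B` seen through the forced-open mask `S`
(the leaf reads the bit of `ω ∨ S`). -/
def go3b (B : ℕ) (S : Fin 10 → Bool) : ℕ → (Fin 10 → Bool) → ℕ
  | 0, ω => (B.testBit (idx2 (orOn S ω))).toNat
  | n + 1, ω => go3b B S n (Function.update ω (Fin.ofNat 10 n) false) +
      KB3 ^ (4 ^ n) * go3b B S n (Function.update ω (Fin.ofNat 10 n) true)

/-- The Kronecker number of the table `T` through the mask `S`, via the bit table. -/
def kron3 (T : (Fin 10 → Bool) → Bool) (S : Fin 10 → Bool) : ℕ := go3b (bits T) S 10 (fun _ => false)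

/-- The positive part of the cleared (ii) on the three-copy pattern `(S₁, S₂, S₃)`:
`kron ABO · kron Q · kron PD + kron QB · kron PDoU · kron A`, each copy through its mask. -/
def posOn (S₁ S₂ S₃ : Fin 10 → Bool) : ℕ :=
  kron3 tABO S₁ * kron3 tQ S₂ * kron3 tPD S₃ + kron3 tQB S₁ * kron3 tPDoU S₂ * kron3 tA S₃

/-- The negative part of the cleared (ii) on the pattern `(S₁, S₂, S₃)`:
`kron QB · kron AO · kron PD + kron AB · kron PDoU · kron Q`. -/
def negOn (S₁ S₂ S₃ : Fin 10 → Bool) : ℕ :=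
  kron3 tQB S₁ * kron3 tAO S₂ * kron3 tPD S₃ + kron3 tAB S₁ * kron3 tPDoU S₂ * kron3 tQ S₃

/-- `N(H + D(1))`, positive part: the extra edge set `D` open in exactly one copy. -/
def posT1 (D : Fin 10 → Bool) : ℕ :=
  posOn D mNone mNone +
  posOn mNone D mNone +
  posOn mNone mNone D

/-- `N(H + D(1))`, negative part. -/
def negT1 (D : Fin 10 → Bool) : ℕ :=
  negOn D mNone mNone +
  negOn mNone D mNone +
  negOn mNone mNone D

/-- `N(H + D(1) + P(1))`, positive part: `D` open in one copy, `P` open in one copy (`9` patterns). -/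
def posT1e1 (D P : Fin 10 → Bool) : ℕ :=
  posOn (mOr D P) mNone mNone +
  posOn D P mNone +
  posOn D mNone P +
  posOn P D mNone +
  posOn mNone (mOr D P) mNone +
  posOn mNone D P +
  posOn P mNone D +
  posOn mNone P D +
  posOn mNone mNone (mOr D P)

/-- `N(H + D(1) + P(1))`, negative part. -/
def negT1e1 (D P : Fin 10 → Bool) : ℕ :=
  negOn (mOr D P) mNone mNone +
  negOn D P mNone +
  negOn D mNone P +
  negOn P D mNone +
  negOn mNone (mOr D P) mNone +
  negOn mNone D P +
  negOn P mNone D +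
  negOn mNone P D +
  negOn mNone mNone (mOr D P)

/-- `N(H + P₁(1) + P₂(1) + P₃(1))`, positive part, the `9` patterns with `P₁` open in the copy `0`. -/
def posE3a (P₁ P₂ P₃ : Fin 10 → Bool) : ℕ :=
  posOn (mOr (mOr P₁ P₂) P₃) mNone mNone +
  posOn (mOr P₁ P₂) P₃ mNone +
  posOn (mOr P₁ P₂) mNone P₃ +
  posOn (mOr P₁ P₃) P₂ mNone +
  posOn P₁ (mOr P₂ P₃) mNone +
  posOn P₁ P₂ P₃ +
  posOn (mOr P₁ P₃) mNone P₂ +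
  posOn P₁ P₃ P₂ +
  posOn P₁ mNone (mOr P₂ P₃)

/-- `N(H + P₁(1) + P₂(1) + P₃(1))`, positive part, the `9` patterns with `P₁` open in the copy `1`. -/
def posE3b (P₁ P₂ P₃ : Fin 10 → Bool) : ℕ :=
  posOn (mOr P₂ P₃) P₁ mNone +
  posOn P₂ (mOr P₁ P₃) mNone +
  posOn P₂ P₁ P₃ +
  posOn P₃ (mOr P₁ P₂) mNone +
  posOn mNone (mOr (mOr P₁ P₂) P₃) mNone +
  posOn mNone (mOr P₁ P₂) P₃ +
  posOn P₃ P₁ P₂ +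
  posOn mNone (mOr P₁ P₃) P₂ +
  posOn mNone P₁ (mOr P₂ P₃)

/-- `N(H + P₁(1) + P₂(1) + P₃(1))`, positive part, the `9` patterns with `P₁` open in the copy `2`. -/
def posE3c (P₁ P₂ P₃ : Fin 10 → Bool) : ℕ :=
  posOn (mOr P₂ P₃) mNone P₁ +
  posOn P₂ P₃ P₁ +
  posOn P₂ mNone (mOr P₁ P₃) +
  posOn P₃ P₂ P₁ +
  posOn mNone (mOr P₂ P₃) P₁ +
  posOn mNone P₂ (mOr P₁ P₃) +
  posOn P₃ mNone (mOr P₁ P₂) +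
  posOn mNone P₃ (mOr P₁ P₂) +
  posOn mNone mNone (mOr (mOr P₁ P₂) P₃)

/-- `N(H + P₁(1) + P₂(1) + P₃(1))`, positive part: three edge sets each open in exactly one copy
(`27` patterns). -/
def posE3 (P₁ P₂ P₃ : Fin 10 → Bool) : ℕ :=
  posE3a P₁ P₂ P₃ + posE3b P₁ P₂ P₃ + posE3c P₁ P₂ P₃

/-- `N(H + P₁(1) + P₂(1) + P₃(1))`, negative part, the `9` patterns with `P₁` open in the copy `0`. -/
def negE3a (P₁ P₂ P₃ : Fin 10 → Bool) : ℕ :=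
  negOn (mOr (mOr P₁ P₂) P₃) mNone mNone +
  negOn (mOr P₁ P₂) P₃ mNone +
  negOn (mOr P₁ P₂) mNone P₃ +
  negOn (mOr P₁ P₃) P₂ mNone +
  negOn P₁ (mOr P₂ P₃) mNone +
  negOn P₁ P₂ P₃ +
  negOn (mOr P₁ P₃) mNone P₂ +
  negOn P₁ P₃ P₂ +
  negOn P₁ mNone (mOr P₂ P₃)

/-- `N(H + P₁(1) + P₂(1) + P₃(1))`, negative part, the `9` patterns with `P₁` open in the copy `1`. -/
def negE3b (P₁ P₂ P₃ : Fin 10 → Bool) : ℕ :=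
  negOn (mOr P₂ P₃) P₁ mNone +
  negOn P₂ (mOr P₁ P₃) mNone +
  negOn P₂ P₁ P₃ +
  negOn P₃ (mOr P₁ P₂) mNone +
  negOn mNone (mOr (mOr P₁ P₂) P₃) mNone +
  negOn mNone (mOr P₁ P₂) P₃ +
  negOn P₃ P₁ P₂ +
  negOn mNone (mOr P₁ P₃) P₂ +
  negOn mNone P₁ (mOr P₂ P₃)

/-- `N(H + P₁(1) + P₂(1) + P₃(1))`, negative part, the `9` patterns with `P₁` open in the copy `2`. -/
def negE3c (P₁ P₂ P₃ : Fin 10 → Bool) : ℕ :=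
  negOn (mOr P₂ P₃) mNone P₁ +
  negOn P₂ P₃ P₁ +
  negOn P₂ mNone (mOr P₁ P₃) +
  negOn P₃ P₂ P₁ +
  negOn mNone (mOr P₂ P₃) P₁ +
  negOn mNone P₂ (mOr P₁ P₃) +
  negOn P₃ mNone (mOr P₁ P₂) +
  negOn mNone P₃ (mOr P₁ P₂) +
  negOn mNone mNone (mOr (mOr P₁ P₂) P₃)

/-- `N(H + P₁(1) + P₂(1) + P₃(1))`, negative part: three edge sets each open in exactly one copy
(`27` patterns). -/
def negE3 (P₁ P₂ P₃ : Fin 10 → Bool) : ℕ :=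
  negE3a P₁ P₂ P₃ + negE3b P₁ P₂ P₃ + negE3c P₁ P₂ P₃

/-- **`M(H, T, e) ≥ 0` as Kronecker numbers**: `kPosM = N(H+T(1)+e(1))⁺ + N(H+T(1))⁻`,
`kNegM = N(H+T(1)+e(1))⁻ + N(H+T(1))⁺`; `M ≥ 0` at every profile iff `kNegM ≤ kPosM` digitwise. -/
def kPosM (D P : Fin 10 → Bool) : ℕ := posT1e1 D P + negT1 D

/-- The negative side of the `M` comparison. -/
def kNegM (D P : Fin 10 → Bool) : ℕ := negT1e1 D P + posT1 D

/-- **`TvT-(ii) ≥ 0` as Kronecker numbers**: `kPosTvT = N(H+△(1,1,1))⁺ + N(H+T(1))⁻` for the triangle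
`△ = {ab, ac, bc}` on `T = {a, b, c}`. -/
def kPosTvT (a b c : ℕ) : ℕ :=
  posE3 (pairMask a b) (pairMask a c) (pairMask b c) + negT1 (triMask a b c)

/-- The negative side of the `TvT` comparison. -/
def kNegTvT (a b c : ℕ) : ℕ :=
  negE3 (pairMask a b) (pairMask a c) (pairMask b c) + posT1 (triMask a b c)

/-- The mask: bit `22` of every base-`KB3` digit below `4^10`. -/
def mask3 : ℕ := 2 ^ 22 * ((KB3 ^ (4 ^ 10) - 1) / (KB3 - 1))

/-- The certificate shape: `kNeg ≤ kPos` digitwise, witnessed by `kNeg ≤ kPos` and the two mask tests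
(no borrow anywhere). -/
def CertLE (kNeg kPos : ℕ) : Prop :=
  kNeg ≤ kPos ∧ Nat.land (kPos - kNeg) mask3 = 0 ∧ Nat.land kNeg mask3 = 0

end K5

end Summit.Ventures.PercRepro2
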